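import Literature.Probability.Distributions.BrascampLiebMomentInequality
import Literature.NumberTheory.LFunctions.XiMomentConcentration
import Literature.NumberTheory.LFunctions.DeBruijnPhiLogConcave
import HarnessLib

/-!
# The ladder tail lemma for `ξ`: Gaussian domination of the bulk moments of `u^kΦ(u)du`

`Literature/NumberTheory/LFunctions/`. Instantiation of Brascamp–Lieb's THEOREM 5.1 (`n = 1`, the tree's
`centredEvenMoment_le_doubleFactorial`, `BrascampLiebMomentInequality.lean`) for the tilted laws
`ν_k ∝ u^kΦ(u)du` restricted to a bulk `[b, ∞)` on which the potential `W_k = −(k log u + log Φ)` has a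
curvature floor `W_k″ ≥ ρ`:

* `xi_bulkEvenMoment_le`: `∫_{[b,∞)} Φu^k (u − c)^{2j} ≤ (2j−1)‼ ρ^{−j} · ∫_{[b,∞)} Φu^k`, `c` the bulk mean
  (in product form), `j ≥ 1`;
* `xi_bulkOddMoment_le`: the odd centred absolute moments by the pointwise
  AM–GM bound `|y|^{2j+1} ≤ ½(t·y^{2j} + y^{2j+2}/t)` (`t > 0`), so that no Gamma value at a half-integer
  is needed downstream.

These are the «G» inputs of `XiTiltedUnconditioning.xiAbsMoment_mean_le_uncondition` in the Jensen track's
THEOREM A (eng-3, LADDER-BL.md §5.5; design HOME/jensen/p1/THEOREM-A-ASSEMBLY.md v0.2 (C)). Hypotheses are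
written out (`W_k″ = k/u² + (Φ′² − ΦΦ″)/Φ²`); the calculus facts are private helpers. Theorems only.

References: Brascamp–Lieb, J. Funct. Anal. 22 (1976), Thm 5.1 [BrascampLieb1976]; Griffin–Ono–Rolen–Zagier,
PNAS 116 (2019), Thm 7 / §5.1 [GORZPNAS2019].
-/

noncomputable section

open MeasureTheory Set Filter
open scoped Topology Nat

namespace Literature.NumberTheory.LFunctions

open Literature.Probability.Distributions

/-! ### Private calculus helpers -/

/-- `e^{−W_k(u)} = Φ(u)u^k` on `(0, ∞)`. [folklore] -/
private theorem exp_neg_W (k : ℕ) {u : ℝ} (hu : 0 < u) :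
    Real.exp (-(-((k : ℝ) * Real.log u + Real.log (deBruijnPhi u)))) = deBruijnPhi u * u ^ k := by
  rw [neg_neg, Real.exp_add, Real.exp_nat_mul, Real.exp_log hu,
    Real.exp_log (deBruijnPhi_pos_holds u)]
  ring

/-- `W_k′ = −(k/u + Φ′/Φ)` on `(0, ∞)`. [folklore] -/
private theorem hasDerivAt_W (k : ℕ) {u : ℝ} (hu : 0 < u) :
    HasDerivAt (fun t => -((k : ℝ) * Real.log t + Real.log (deBruijnPhi t)))
      (-((k : ℝ) / u + deBruijnPhiDeriv u / deBruijnPhi u)) u := by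
  have h1 : HasDerivAt (fun t => (k : ℝ) * Real.log t) ((k : ℝ) * u⁻¹) u :=
    (Real.hasDerivAt_log hu.ne').const_mul _
  have h : HasDerivAt (fun t => -((k : ℝ) * Real.log t + Real.log (deBruijnPhi t)))
      (-((k : ℝ) * u⁻¹ + deBruijnPhiDeriv u / deBruijnPhi u)) u :=
    (h1.add (hasDerivAt_log_deBruijnPhi u)).neg
  exact h.congr_deriv (by simp only [div_eq_mul_inv])

/-- `W_k″ = k/u² + (Φ′² − ΦΦ″)/Φ²` on `(0, ∞)`. [folklore] -/
private theorem hasDerivAt_W' (k : ℕ) {u : ℝ} (hu : 0 < u) :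
    HasDerivAt (fun t => -((k : ℝ) / t + deBruijnPhiDeriv t / deBruijnPhi t))
      ((k : ℝ) / u ^ 2 +
        (deBruijnPhiDeriv u ^ 2 - deBruijnPhi u * deBruijnPhiDeriv₂ u) / deBruijnPhi u ^ 2) u := by
  have h1 : HasDerivAt (fun t => (k : ℝ) / t) ((0 * u - (k : ℝ) * 1) / u ^ 2) u :=
    (hasDerivAt_const u (k : ℝ)).div (hasDerivAt_id' u) hu.ne'
  have h : HasDerivAt (fun t => -((k : ℝ) / t + deBruijnPhiDeriv t / deBruijnPhi t))
      (-((0 * u - (k : ℝ) * 1) / u ^ 2 +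
        (deBruijnPhiDeriv₂ u * deBruijnPhi u - deBruijnPhiDeriv u * deBruijnPhiDeriv u) /
          deBruijnPhi u ^ 2)) u := (h1.add (hasDerivAt_deriv_log_deBruijnPhi u)).neg
  refine h.congr_deriv ?_
  have hΦ := (deBruijnPhi_pos_holds u).ne'
  have hu' := hu.ne'
  field_simp
  ring

/-- Convexity of `W_k − (ρ/2)u²` on `[b, ∞)` (`b > 0`) under the floor `W_k″ ≥ ρ` there. [folklore] -/
private theorem convexOn_W_sub_sq (k : ℕ) {b ρ : ℝ} (hb : 0 < b)
    (hfloor : ∀ u : ℝ, 0 < u → b ≤ u → ρ ≤ (k : ℝ) / u ^ 2 +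
      (deBruijnPhiDeriv u ^ 2 - deBruijnPhi u * deBruijnPhiDeriv₂ u) / deBruijnPhi u ^ 2) :
    ConvexOn ℝ (Ici b)
      (fun t => -((k : ℝ) * Real.log t + Real.log (deBruijnPhi t)) - ρ / 2 * t ^ 2) := by
  set f : ℝ → ℝ := fun t => -((k : ℝ) * Real.log t + Real.log (deBruijnPhi t)) - ρ / 2 * t ^ 2 with hf
  set f₁ : ℝ → ℝ := fun t => -((k : ℝ) / t + deBruijnPhiDeriv t / deBruijnPhi t) - ρ * t with hf₁
  set f₂ : ℝ → ℝ := fun t => (k : ℝ) / t ^ 2 +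
    (deBruijnPhiDeriv t ^ 2 - deBruijnPhi t * deBruijnPhiDeriv₂ t) / deBruijnPhi t ^ 2 - ρ with hf₂
  have hsq : ∀ t : ℝ, HasDerivAt (fun y : ℝ => ρ / 2 * y ^ 2) (ρ * t) t := by
    intro t
    have := ((hasDerivAt_id t).mul (hasDerivAt_id t)).const_mul (ρ / 2)
    have e : (fun y : ℝ => ρ / 2 * y ^ 2) = fun y => ρ / 2 * (id y * id y) := by
      funext y; simp only [id]; ring
    rw [e]; exact this.congr_deriv (by simp only [id]; ring)
  have hlin : ∀ t : ℝ, HasDerivAt (fun y : ℝ => ρ * y) ρ t := fun t => by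
    simpa using (hasDerivAt_id t).const_mul ρ
  have hfd : ∀ x ∈ Ioi (0 : ℝ), HasDerivAt f (f₁ x) x := fun x hx => (hasDerivAt_W k hx).sub (hsq x)
  have hf₁d : ∀ x ∈ Ioi (0 : ℝ), HasDerivAt f₁ (f₂ x) x := fun x hx => (hasDerivAt_W' k hx).sub (hlin x)
  have hsub : Ici b ⊆ Ioi (0 : ℝ) := fun u hu => lt_of_lt_of_le hb hu
  have hint : interior (Ici b) = Ioi b := interior_Ici
  have hsub' : Ioi b ⊆ Ioi (0 : ℝ) := fun u hu => lt_trans hb hu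
  have hderiv : ∀ x ∈ Ioi b, deriv f x = f₁ x := fun x hx => (hfd x (hsub' hx)).deriv
  refine convexOn_of_deriv2_nonneg (convex_Ici b)
    (fun x hx => (hfd x (hsub hx)).continuousAt.continuousWithinAt) ?_ ?_ ?_
  · rw [hint]; exact fun x hx => (hfd x (hsub' hx)).differentiableAt.differentiableWithinAt
  · rw [hint]
    have h : DifferentiableOn ℝ f₁ (Ioi b) :=
      fun x hx => (hf₁d x (hsub' hx)).differentiableAt.differentiableWithinAt
    exact h.congr fun x hx => hderiv x hx
  · rw [hint]
    intro x hx
    have heq : deriv f =ᶠ[𝓝 x] f₁ :=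
      Filter.eventuallyEq_of_mem (Ioi_mem_nhds hx) fun y hy => hderiv y hy
    rw [Function.iterate_succ_apply, Function.iterate_one, heq.deriv_eq, (hf₁d x (hsub' hx)).deriv]
    have := hfloor x (hsub' hx) hx.le
    simp only [hf₂]; linarith

/-! ### Even bulk moments: Gaussian domination -/

/-- **Even centred bulk moments of `u^kΦ(u)du` are dominated by the Gaussian of curvature `ρ`.**
If `b > 0`, `W_k″ ≥ ρ > 0` on `[b, ∞)` and `c` is the mean of the bulk (`(∫_{[b,∞)} Φu^k)·c = ∫_{[b,∞)} Φu^k·u`),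
then for every `j ≥ 1`: `∫_{[b,∞)} Φu^k (u − c)^{2j} ≤ (2j−1)‼/ρ^j · ∫_{[b,∞)} Φu^k`.
[cite: BrascampLieb1976, Thm 5.1 (n = 1)] -/
theorem xi_bulkEvenMoment_le (k : ℕ) {j : ℕ} (hj : j ≠ 0) {b ρ c : ℝ} (hb : 0 < b) (hρ : 0 < ρ)
    (hfloor : ∀ u : ℝ, 0 < u → b ≤ u → ρ ≤ (k : ℝ) / u ^ 2 +
      (deBruijnPhiDeriv u ^ 2 - deBruijnPhi u * deBruijnPhiDeriv₂ u) / deBruijnPhi u ^ 2)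
    (hc : (∫ u in Ici b, deBruijnPhi u * u ^ k) * c = ∫ u in Ici b, deBruijnPhi u * u ^ k * u) :
    ∫ u in Ici b, deBruijnPhi u * u ^ k * (u - c) ^ (2 * j) ≤
      ((2 * j - 1 : ℕ)‼ : ℝ) / ρ ^ j * ∫ u in Ici b, deBruijnPhi u * u ^ k := by
  set g : ℝ → ℝ := fun t => -((k : ℝ) * Real.log t + Real.log (deBruijnPhi t)) with hg
  have hsub : Ici b ⊆ Ioi (0 : ℝ) := fun u hu => lt_of_lt_of_le hb hu
  have hexp : EqOn (fun x => Real.exp (-g x)) (fun x => deBruijnPhi x * x ^ k) (Ici b) :=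
    fun x hx => exp_neg_W k (hsub hx)
  -- integrability of the monomial moments on the bulk
  have hint : ∀ m : ℕ, IntegrableOn (fun x => x ^ m * Real.exp (-g x)) (Ici b) := by
    intro m
    have h := (integrableOn_deBruijnPhi_mul_pow (k + m)).mono_set hsub
    refine h.congr_fun (fun x hx => ?_) measurableSet_Ici
    simp only [hexp hx, pow_add]; ring
  have eZ : ∫ x in Ici b, Real.exp (-g x) = ∫ u in Ici b, deBruijnPhi u * u ^ k :=
    setIntegral_congr_fun measurableSet_Ici hexp
  have e1 : ∫ x in Ici b, x * Real.exp (-g x) = ∫ u in Ici b, deBruijnPhi u * u ^ k * u :=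
    setIntegral_congr_fun measurableSet_Ici fun x hx => by simp only [hexp hx]; ring
  have e2 : ∫ x in Ici b, (x - c) ^ (2 * j) * Real.exp (-g x) =
      ∫ u in Ici b, deBruijnPhi u * u ^ k * (u - c) ^ (2 * j) :=
    setIntegral_congr_fun measurableSet_Ici fun x hx => by simp only [hexp hx]; ring
  have hZ : 0 < ∫ x in Ici b, Real.exp (-g x) := by
    rw [eZ]
    have hint0 : IntegrableOn (fun u : ℝ => deBruijnPhi u * u ^ k) (Ici b) :=
      (integrableOn_deBruijnPhi_mul_pow k).mono_set hsub
    rw [setIntegral_pos_iff_support_of_nonneg_ae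
      (ae_restrict_of_forall_mem measurableSet_Ici fun u hu =>
        (mul_pos (deBruijnPhi_pos_holds u) (pow_pos (hsub hu) k)).le) hint0]
    have hs' : Ici b ⊆ (Function.support fun u : ℝ => deBruijnPhi u * u ^ k) ∩ Ici b :=
      fun u hu => ⟨(mul_pos (deBruijnPhi_pos_holds u) (pow_pos (hsub hu) k)).ne', hu⟩
    refine lt_of_lt_of_le ?_ (measure_mono hs')
    rw [Real.volume_Ici]; exact ENNReal.zero_lt_top
  have hm : c * ∫ x in Ici b, Real.exp (-g x) = ∫ x in Ici b, x * Real.exp (-g x) := by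
    rw [eZ, e1, mul_comm]; exact hc
  have h := centredEvenMoment_le_doubleFactorial hρ ordConnected_Ici (convexOn_W_sub_sq k hb hfloor)
    hint hZ hm hj
  rw [div_le_iff₀ hZ, e2, eZ] at h
  exact h

/-! ### Odd bulk moments by AM–GM -/

/-- Pointwise AM–GM: `|y|^{2j+1} ≤ (t·y^{2j} + y^{2(j+1)}/t)/2` for `t > 0` (private helper). [folklore] -/
private theorem abs_pow_odd_le_amgm (y : ℝ) (j : ℕ) {t : ℝ} (ht : 0 < t) :
    |y| ^ (2 * j + 1) ≤ (t * y ^ (2 * j) + y ^ (2 * (j + 1)) / t) / 2 := by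
  have hsq := sq_nonneg (t * |y| ^ j - |y| ^ (j + 1))
  have e1 : y ^ (2 * j) = (|y| ^ j) ^ 2 := by
    rw [← pow_mul, mul_comm j 2, (even_two_mul j).pow_abs]
  have e2 : y ^ (2 * (j + 1)) = (|y| ^ (j + 1)) ^ 2 := by
    rw [← pow_mul, mul_comm (j + 1) 2, (even_two_mul (j + 1)).pow_abs]
  have e3 : |y| ^ (2 * j + 1) = |y| ^ j * |y| ^ (j + 1) := by rw [← pow_add]; congr 1; ring
  rw [e1, e2, e3, le_div_iff₀ (by norm_num : (0 : ℝ) < 2)]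
  have key : t * (|y| ^ j) ^ 2 + (|y| ^ (j + 1)) ^ 2 / t - 2 * (|y| ^ j * |y| ^ (j + 1)) =
      (t * |y| ^ j - |y| ^ (j + 1)) ^ 2 / t := by
    field_simp; ring
  have : 0 ≤ (t * |y| ^ j - |y| ^ (j + 1)) ^ 2 / t := div_nonneg hsq ht.le
  linarith

/-- **Odd centred absolute bulk moments of `u^kΦ(u)du`** by AM–GM from the two neighbouring even ones:
under the hypotheses of `xi_bulkEvenMoment_le`, for `j ≥ 1` and any `t > 0`,
`∫_{[b,∞)} Φu^k |u − c|^{2j+1} ≤ ½(t·(2j−1)‼/ρ^j + (2j+1)‼/(ρ^{j+1}t)) · ∫_{[b,∞)} Φu^k`.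
[cite: BrascampLieb1976, Thm 5.1 (n = 1)] -/
theorem xi_bulkOddMoment_le (k : ℕ) {j : ℕ} (hj : j ≠ 0) {b ρ c t : ℝ} (hb : 0 < b) (hρ : 0 < ρ)
    (ht : 0 < t)
    (hfloor : ∀ u : ℝ, 0 < u → b ≤ u → ρ ≤ (k : ℝ) / u ^ 2 +
      (deBruijnPhiDeriv u ^ 2 - deBruijnPhi u * deBruijnPhiDeriv₂ u) / deBruijnPhi u ^ 2)
    (hc : (∫ u in Ici b, deBruijnPhi u * u ^ k) * c = ∫ u in Ici b, deBruijnPhi u * u ^ k * u) :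
    ∫ u in Ici b, deBruijnPhi u * u ^ k * |u - c| ^ (2 * j + 1) ≤
      (t * (((2 * j - 1 : ℕ)‼ : ℝ) / ρ ^ j) + (((2 * (j + 1) - 1 : ℕ)‼ : ℝ) / ρ ^ (j + 1)) / t) / 2 *
        ∫ u in Ici b, deBruijnPhi u * u ^ k := by
  have hsub : Ici b ⊆ Ioi (0 : ℝ) := fun u hu => lt_of_lt_of_le hb hu
  have hw0 : ∀ u ∈ Ici b, 0 ≤ deBruijnPhi u * u ^ k :=
    fun u hu => (mul_pos (deBruijnPhi_pos_holds u) (pow_pos (hsub hu) k)).le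
  have he1 := xi_bulkEvenMoment_le k hj hb hρ hfloor hc
  have he2 := xi_bulkEvenMoment_le k (Nat.succ_ne_zero j) hb hρ hfloor hc
  have iAbs : IntegrableOn (fun u => deBruijnPhi u * u ^ k * |u - c| ^ (2 * j + 1)) (Ici b) :=
    (integrableOn_deBruijnPhi_mul_pow_mul_abs_pow k (2 * j + 1) c).mono_set hsub
  have iEv1 : IntegrableOn (fun u => deBruijnPhi u * u ^ k * (u - c) ^ (2 * j)) (Ici b) :=
    (integrableOn_deBruijnPhi_mul_pow_mul_sub_pow k (2 * j) c).mono_set hsub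
  have iEv2 : IntegrableOn (fun u => deBruijnPhi u * u ^ k * (u - c) ^ (2 * (j + 1))) (Ici b) :=
    (integrableOn_deBruijnPhi_mul_pow_mul_sub_pow k (2 * (j + 1)) c).mono_set hsub
  have hpt : ∀ u ∈ Ici b, deBruijnPhi u * u ^ k * |u - c| ^ (2 * j + 1) ≤
      t / 2 * (deBruijnPhi u * u ^ k * (u - c) ^ (2 * j)) +
        t⁻¹ / 2 * (deBruijnPhi u * u ^ k * (u - c) ^ (2 * (j + 1))) := by
    intro u hu
    have h := mul_le_mul_of_nonneg_left (abs_pow_odd_le_amgm (u - c) j ht) (hw0 u hu)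
    calc deBruijnPhi u * u ^ k * |u - c| ^ (2 * j + 1)
        ≤ deBruijnPhi u * u ^ k * ((t * (u - c) ^ (2 * j) + (u - c) ^ (2 * (j + 1)) / t) / 2) := h
      _ = _ := by rw [div_eq_mul_inv _ t]; ring
  have hI0 : 0 ≤ ∫ u in Ici b, deBruijnPhi u * u ^ k := setIntegral_nonneg measurableSet_Ici hw0
  have hA : t / 2 * (∫ u in Ici b, deBruijnPhi u * u ^ k * (u - c) ^ (2 * j)) ≤
      t / 2 * (((2 * j - 1 : ℕ)‼ : ℝ) / ρ ^ j * ∫ u in Ici b, deBruijnPhi u * u ^ k) :=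
    mul_le_mul_of_nonneg_left he1 (by positivity)
  have hB : t⁻¹ / 2 * (∫ u in Ici b, deBruijnPhi u * u ^ k * (u - c) ^ (2 * (j + 1))) ≤
      t⁻¹ / 2 * ((((2 * (j + 1) - 1 : ℕ)‼ : ℝ) / ρ ^ (j + 1)) * ∫ u in Ici b, deBruijnPhi u * u ^ k) :=
    mul_le_mul_of_nonneg_left he2 (by positivity)
  calc ∫ u in Ici b, deBruijnPhi u * u ^ k * |u - c| ^ (2 * j + 1)
      ≤ ∫ u in Ici b, (t / 2 * (deBruijnPhi u * u ^ k * (u - c) ^ (2 * j)) +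
          t⁻¹ / 2 * (deBruijnPhi u * u ^ k * (u - c) ^ (2 * (j + 1)))) :=
        setIntegral_mono_on iAbs ((iEv1.const_mul _).add (iEv2.const_mul _)) measurableSet_Ici hpt
    _ = t / 2 * (∫ u in Ici b, deBruijnPhi u * u ^ k * (u - c) ^ (2 * j)) +
          t⁻¹ / 2 * ∫ u in Ici b, deBruijnPhi u * u ^ k * (u - c) ^ (2 * (j + 1)) := by
        rw [integral_add (iEv1.const_mul _) (iEv2.const_mul _), integral_const_mul, integral_const_mul]
    _ ≤ t / 2 * (((2 * j - 1 : ℕ)‼ : ℝ) / ρ ^ j * ∫ u in Ici b, deBruijnPhi u * u ^ k) +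
          t⁻¹ / 2 * ((((2 * (j + 1) - 1 : ℕ)‼ : ℝ) / ρ ^ (j + 1)) *
            ∫ u in Ici b, deBruijnPhi u * u ^ k) := add_le_add hA hB
    _ = _ := by rw [div_eq_mul_inv _ t]; ring

end Literature.NumberTheory.LFunctions
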